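import Summits.NavierStokesRegularity.NavierStokesRegularity.Theorems.SoloRefuteGeorgievDavidi2021Cell
import HarnessLib

/-!
# NS-claims map, C31 `GeorgievDavidi2021` (arXiv:1806.10081 v10): kernel refutation of Step 4 (`Step4_compact`,
# the compactness sentence p.12 l.9–11) at DECOMPOSITION grain — companion of `SoloRefuteGeorgievDavidi2021Cell.lean` (imported)

`Step4_compact` (the decl consumed by `claim_of_steps`) quantifies over admissible decompositions `𝒟`, data `U₀`
with `DataHyp 𝒟 U₀`, cells `j`, admissible `ε` and intervals `[m, m+1]`, and asserts `CompactAt 𝒟 j ε m`: the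
norm-balls of radii `M_{1j}` and `(1+ε)M_{1j}` of `E(D_jj)` over `D_j` are (sequentially, relatively) compact.
This file builds ONE instance of the standing setting and applies the witness of the companion file:

* `cubeDecomposition` — an admissible decomposition of `ℝ³` (conditions 1.–4. as typed in `Decomposition`):
  half-open unit cubes `∏ᵢ [zᵢ, zᵢ+1)`, `z ∈ ℤ³` enumerated by `ℕ`, cores `closedBall (z + (½,½,½)) ¼`, base
  points `z + (¾,½,½) ∈ ∂core`, «adjoining» := `True` (uninterpreted in print); `μ(D_z) = 1`, 2D slices are unit
  squares and 1D slices unit intervals (measure `1 ≤ 1`).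
* `dataHyp_zero` — the zero datum satisfies every hypothesis of Theorem 1.1 (the authors' Remark 1.2 case);
  `epsAdmissible_zero` — `ε = 1/(3M_{1j}+7)` is admissible with `N_{1j} = 0` (p.12 l.1–4).
* `not_Step4_compact` — **the deciding theorem**: `¬ Step4_compact`, at cell `0`, interval `[0,1]`, radius
  `M_{1j} > 0` (`M_pos`), by `not_ballCompact` (companion file) with `x₀` = the core's centre, `r = ¼`.

Classification (cell vocabulary): false lemma (countermodel) at p.12 l.9–11 (print p.12); the printed proof of the
load-bearing Theorem 1.1 (p.3 l.13 – p.4 l.61, `ClaimedTheorem` via `claim_of_steps`) does not go through.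
Axioms: `propext`, `Classical.choice`, `Quot.sound`.
WHAT THIS IS NOT: not a claim about NS regularity or blow-up; not a claim about any author beyond the typed locator.
-/

set_option linter.dupNamespace false

noncomputable section

namespace Summit.NavierStokesRegularity.NavierStokesRegularity.Theorems.GeorgievDavidi2021

open scoped ContDiff ENNReal
open Set Filter Topology Metric Real MeasureTheory
open Literature.Claims.NS.GeorgievDavidi2021

/-! ## An admissible decomposition of `ℝ³`: half-open unit cubes with closed-ball cores

`D_z = ∏ᵢ [zᵢ, zᵢ+1)` (`z ∈ ℤ³`, enumerated by `ℕ`), core `D_zz = closedBall (z + (½,½,½)) ¼`, base point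
`z + (¾,½,½) ∈ ∂D_zz`, «adjoining» := `True` (uninterpreted in print). All of conditions 1.–4. (as typed in
`Decomposition`) hold: the cells are disjoint and cover `ℝ³`, `μ(D_z) = 1`, every 2D slice is a unit square
(measure `1 ≤ 1`) and every 1D slice a unit interval (measure `1 ≤ 1`). -/

/-- the half-open unit cube with integer corner `z` -/
def cube (z : Fin 3 → ℤ) : Set E3 := {x | ∀ i, (z i : ℝ) ≤ x i ∧ x i < z i + 1}

/-- its centre `z + (½,½,½)` -/
def ctr (z : Fin 3 → ℤ) : E3 := mk3 (z 0 + 1 / 2) (z 1 + 1 / 2) (z 2 + 1 / 2)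

/-- coordinates of the centre -/
theorem ctr_apply (z : Fin 3 → ℤ) (i : Fin 3) : ctr z i = z i + 1 / 2 := by
  fin_cases i <;> simp [ctr, mk3]

/-- the base point `z + (¾,½,½)` on the boundary of the core -/
def basePt (z : Fin 3 → ℤ) : E3 := ctr z + (1 / 4 : ℝ) • ev 0

/-- an enumeration of `ℤ³` by `ℕ` -/
def idx : ℕ ≃ (Fin 3 → ℤ) :=
  haveI := Encodable.ofCountable (Fin 3 → ℤ)
  haveI := Denumerable.ofEncodableOfInfinite (Fin 3 → ℤ)
  (Denumerable.eqv (Fin 3 → ℤ)).symm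

/-- every point lies in the cube of its integer parts (cover) -/
theorem mem_cube_floor (x : E3) : x ∈ cube (fun i => ⌊x i⌋) :=
  fun k => ⟨Int.floor_le (x k), Int.lt_floor_add_one (x k)⟩

/-- distinct cubes are disjoint (condition 1.) -/
theorem cube_disjoint {z z' : Fin 3 → ℤ} (h : z ≠ z') : Disjoint (cube z) (cube z') := by
  rw [Set.disjoint_left]
  intro x hx hx'
  apply h
  funext i
  have h1 : ⌊x i⌋ = z i := Int.floor_eq_iff.2 ⟨(hx i).1, (hx i).2⟩
  have h2 : ⌊x i⌋ = z' i := Int.floor_eq_iff.2 ⟨(hx' i).1, (hx' i).2⟩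
  rw [← h1, ← h2]

/-- the centre lies in its cube -/
theorem ctr_mem_cube (z : Fin 3 → ℤ) : ctr z ∈ cube z := by
  intro i; rw [ctr_apply]; constructor <;> linarith

/-- the cube is bounded: inside `closedBall centre 1` -/
theorem cube_subset_closedBall (z : Fin 3 → ℤ) : cube z ⊆ closedBall (ctr z) 1 := by
  intro x hx
  rw [mem_closedBall, EuclideanSpace.dist_eq]
  have hb : ∀ i, dist (x i) (ctr z i) ^ 2 ≤ 1 / 4 := by
    intro i
    have h1 := (hx i).1
    have h2 := (hx i).2
    rw [ctr_apply, Real.dist_eq]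
    have : |x i - (z i + 1 / 2)| ≤ 1 / 2 := abs_le.2 ⟨by linarith, by linarith⟩
    nlinarith [abs_nonneg (x i - (z i + 1 / 2)), sq_abs (x i - (z i + 1 / 2))]
  have hs : ∑ i, dist (x i) (ctr z i) ^ 2 ≤ 1 := by
    rw [Fin.sum_univ_three]; linarith [hb 0, hb 1, hb 2]
  calc √(∑ i, dist (x i) (ctr z i) ^ 2) ≤ √1 := Real.sqrt_le_sqrt hs
    _ = 1 := Real.sqrt_one

/-- the core lies in the cube (condition 4.) -/
theorem core_subset_cube (z : Fin 3 → ℤ) : closedBall (ctr z) (1 / 4) ⊆ cube z := by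
  intro y hy i
  rw [mem_closedBall] at hy
  have h := le_trans (PiLp.dist_apply_le y (ctr z) i) hy
  rw [ctr_apply, Real.dist_eq] at h
  obtain ⟨h1, h2⟩ := abs_le.1 h
  constructor <;> linarith

/-- the core is a proper subset (condition 4.): the face-centre `z + (0,½,½)` is in the cube, not the core -/
theorem core_ne_cube (z : Fin 3 → ℤ) : closedBall (ctr z) (1 / 4) ≠ cube z := by
  intro h
  set q : E3 := mk3 (z 0) (z 1 + 1 / 2) (z 2 + 1 / 2) with hq
  have hq0 : q 0 = z 0 := by simp [hq, mk3]
  have hmem : q ∈ cube z := by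
    intro i
    fin_cases i <;> simp [hq, mk3] <;> norm_num
  rw [← h, mem_closedBall] at hmem
  have hle := le_trans (PiLp.dist_apply_le q (ctr z) 0) hmem
  rw [hq0, ctr_apply, Real.dist_eq] at hle
  have habs : |((z 0 : ℤ) : ℝ) - (z 0 + 1 / 2)| = 1 / 2 := by
    rw [show ((z 0 : ℤ) : ℝ) - (z 0 + 1 / 2) = -(1 / 2) by ring, abs_neg, abs_of_pos (by norm_num)]
  rw [habs] at hle
  norm_num at hle

/-- the base point lies on the boundary sphere of the core (condition 4.) -/
theorem basePt_mem_frontier (z : Fin 3 → ℤ) : basePt z ∈ frontier (closedBall (ctr z) (1 / 4)) := by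
  rw [frontier_closedBall _ (by norm_num : (1 / 4 : ℝ) ≠ 0), mem_sphere, basePt, dist_eq_norm,
    add_sub_cancel_left, norm_smul]
  simp

/-- cubes are measurable -/
theorem measurableSet_cube (z : Fin 3 → ℤ) : MeasurableSet (cube z) := by
  have : cube z = ⋂ i, (fun x : E3 => x i) ⁻¹' Ico (z i : ℝ) (z i + 1) := by
    ext x; simp [cube]
  rw [this]
  exact MeasurableSet.iInter fun i => measurableSet_Ico.preimage (by fun_prop)

/-- `μ(∏ᵢ [wᵢ, wᵢ+1)) = 1` in `EuclideanSpace ℝ ι`. -/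
theorem volume_unitCube {ι : Type} [Fintype ι] (w : ι → ℤ) :
    volume {x : EuclideanSpace ℝ ι | ∀ i, (w i : ℝ) ≤ x i ∧ x i < w i + 1} = 1 := by
  have hset : {x : EuclideanSpace ℝ ι | ∀ i, (w i : ℝ) ≤ x i ∧ x i < w i + 1} =
      (@WithLp.ofLp 2 (ι → ℝ)) ⁻¹' (Set.pi univ fun i => Ico (w i : ℝ) (w i + 1)) := by
    ext x; simp [Set.mem_pi]
  rw [hset, (PiLp.volume_preserving_ofLp ι).measure_preimage
    (MeasurableSet.univ_pi fun i => measurableSet_Ico).nullMeasurableSet, volume_pi_pi]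
  simp [Real.volume_Ico]

/-- `μ(D_z) = 1` -/
theorem volume_cube (z : Fin 3 → ℤ) : volume (cube z) = 1 := volume_unitCube z

/-- `μ([c, c+1)) = 1` -/
theorem volume_Ico_unit (c : ℤ) : volume (Ico (c : ℝ) (c + 1)) = 1 := by
  rw [Real.volume_Ico]; simp

/-- **The decomposition instance** (all of conditions 1.–4. as typed). -/
def cubeDecomposition : Decomposition where
  D j := cube (idx j)
  Djj j := closedBall (ctr (idx j)) (1 / 4)
  base j := basePt (idx j)
  adjoining _ _ := True
  cover x := ⟨idx.symm (fun i => ⌊x i⌋), by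
    show x ∈ cube (idx (idx.symm fun i => ⌊x i⌋))
    rw [Equiv.apply_symm_apply]; exact mem_cube_floor x⟩
  bounded j := isBounded_closedBall.subset (cube_subset_closedBall _)
  measurable j := measurableSet_cube _
  vol_pos j := by
    show 0 < volume (cube (idx j))
    rw [volume_cube]; exact one_pos
  disjoint i j hij := cube_disjoint fun h => hij (idx.injective h)
  adj _ := trivial
  slice_x j p _ := by
    show volume {q : EuclideanSpace ℝ (Fin 2) | mk3 (p 0) (q 0) (q 1) ∈ cube (idx j)} ≤ volume (cube (idx j))
    rw [volume_cube, ← volume_unitCube ![idx j 1, idx j 2]]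
    refine measure_mono fun q hq => ?_
    have h1 := hq 1
    have h2 := hq 2
    simp only [mk3, mem_setOf_eq] at h1 h2 ⊢
    intro i
    fin_cases i <;> simp_all
  slice_y j p _ := by
    show volume {q : EuclideanSpace ℝ (Fin 2) | mk3 (q 0) (p 1) (q 1) ∈ cube (idx j)} ≤ volume (cube (idx j))
    rw [volume_cube, ← volume_unitCube ![idx j 0, idx j 2]]
    refine measure_mono fun q hq => ?_
    have h1 := hq 0
    have h2 := hq 2
    simp only [mk3, mem_setOf_eq] at h1 h2 ⊢
    intro i
    fin_cases i <;> simp_all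
  slice_z j p _ := by
    show volume {q : EuclideanSpace ℝ (Fin 2) | mk3 (q 0) (q 1) (p 2) ∈ cube (idx j)} ≤ volume (cube (idx j))
    rw [volume_cube, ← volume_unitCube ![idx j 0, idx j 1]]
    refine measure_mono fun q hq => ?_
    have h1 := hq 0
    have h2 := hq 1
    simp only [mk3, mem_setOf_eq] at h1 h2 ⊢
    intro i
    fin_cases i <;> simp_all
  slice_xy j p _ := by
    show volume {s : ℝ | mk3 (p 0) (p 1) s ∈ cube (idx j)} ≤ volume (cube (idx j))
    rw [volume_cube, ← volume_Ico_unit (idx j 2)]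
    refine measure_mono fun s hs => ?_
    have h := hs 2
    simpa [mk3] using h
  slice_xz j p _ := by
    show volume {s : ℝ | mk3 (p 0) s (p 2) ∈ cube (idx j)} ≤ volume (cube (idx j))
    rw [volume_cube, ← volume_Ico_unit (idx j 1)]
    refine measure_mono fun s hs => ?_
    have h := hs 1
    simpa [mk3] using h
  slice_yz j p _ := by
    show volume {s : ℝ | mk3 s (p 1) (p 2) ∈ cube (idx j)} ≤ volume (cube (idx j))
    rw [volume_cube, ← volume_Ico_unit (idx j 0)]
    refine measure_mono fun s hs => ?_
    have h := hs 0
    simpa [mk3] using h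
  compact j := isCompact_closedBall _ _
  core_sub j := core_subset_cube _
  core_ne j := core_ne_cube _
  base_mem j := basePt_mem_frontier _

/-! ## The zero datum (the authors' own Remark 1.2 case) and an admissible `ε` -/

/-- partial derivatives of a constant vanish -/
theorem pd_const (k : Fin 3) (c : ℝ) : pd k (fun _ : E3 => c) = fun _ => 0 := by
  funext x; simp [pd]

/-- `U₀ ≡ 0` satisfies every hypothesis of Theorem 1.1 (Remark 1.2 of the print). -/
theorem dataHyp_zero : DataHyp cubeDecomposition (fun _ => 0) where
  smooth := contDiff_const
  decay n K := ⟨0, fun x => by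
    have : iteratedFDeriv ℝ n (fun _ : E3 => (0 : E3)) x = 0 := by
      rw [iteratedFDeriv_fun_zero]; rfl
    rw [this, norm_zero, mul_zero]⟩
  support _ _ _ _ := rfl
  l2 i := by simp
  sup0 j i x _ := by simpa using M_pos cubeDecomposition j
  sup1 j i k x _ := by
    have : (fun y : E3 => (0 : E3) i) = fun _ => (0 : ℝ) := by funext y; simp
    rw [this, pd_const]; simpa using M_pos cubeDecomposition j
  sup2 j i k x _ := by
    have : (fun y : E3 => (0 : E3) i) = fun _ => (0 : ℝ) := by funext y; simp
    rw [this, pd_const, pd_const]; simpa using M_pos cubeDecomposition j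

/-- With `N_{1j} = 0` the choice `ε = 1/(3M_{1j} + 7)` satisfies `ε(3M² + 6M + N)μ(D_j)² ≤ M` (p.12 l.1–4). -/
theorem epsAdmissible_zero (j : ℕ) :
    EpsAdmissible cubeDecomposition (fun _ => 0) j (1 / (3 * M cubeDecomposition j + 7)) := by
  have hM := M_pos cubeDecomposition j
  refine ⟨by positivity, 0, fun x _ i => by simp, ?_⟩
  have hvol : (volume (cubeDecomposition.D j)).toReal = 1 := by
    show (volume (cube (idx j))).toReal = 1
    rw [volume_cube]; simp
  rw [hvol, one_pow, mul_one, add_zero, div_mul_eq_mul_div, one_mul, div_le_iff₀ (by positivity)]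
  nlinarith

/-- **Refutes `Step4_compact`** (Step 4, p.12 l.9–11 — the decl consumed by `claim_of_steps`): for the unit-cube
decomposition, the zero datum, cell `0`, the admissible `ε = 1/(3M+7)` and the first interval `[0,1]`, the
norm-ball `X¹` of radius `M_{1j}` in `E¹(D_jj)` contains the sequence `c·β(x)·sin(2π2ⁿt)/(2π2ⁿ)` with no
`‖·‖`-Cauchy subsequence, so it is not compact. -/
theorem not_Step4_compact : ¬ Step4_compact := by
  intro h
  have hC := (h cubeDecomposition (fun _ => 0) dataHyp_zero 0 _ (epsAdmissible_zero 0) 0).1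
  exact not_ballCompact (D := cube (idx 0)) (K := closedBall (ctr (idx 0)) (1 / 4)) (x₀ := ctr (idx 0))
    (r := 1 / 4) (by norm_num) subset_rfl (ctr_mem_cube _)
    (isBounded_closedBall.subset (cube_subset_closedBall _)) _ (M_pos cubeDecomposition 0) hC

end Summit.NavierStokesRegularity.NavierStokesRegularity.Theorems.GeorgievDavidi2021

end
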